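import Literature.NumberTheory.EllipticCurves.Rank1Residual.Predicates
import HarnessLib

/-!
# Jetchev–Skinner–Wan 2017, §7.4 (first paragraph): a semistable `E/ℚ` with `E[p]` irreducible at a
# good prime `p` has a prime `q ∥ N` at which `ρ̄_{E,p}` is ramified (Ribet's level lowering + no
# weight-2 level-1 cusp forms)

Source: D. Jetchev, C. Skinner, X. Wan, *The Birch and Swinnerton-Dyer formula for elliptic curves
of analytic rank one*, Camb. J. Math. 5 (2017), no. 3, 369–434, doi:10.4310/CJM.2017.v5.n3.a2
(= arXiv:1512.06894), §7.4 "The final argument", first paragraph (PUBLISHED, refereed); read by the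
vendoring seat on the store text `paper:arxiv-1512.06894` (p0029 L90–L97), with the standing
assumptions of §7 (p0028 L3–L21).

Verbatim (§7.4, arXiv p. 29): "Let `f ∈ S_2(Γ_0(N))` be the Hecke eigenform associated to `E`. Then
`(V,T,W) = (V_f,T_f,W_f) = (V_pE, T_pE, E[p^∞])`, `𝒪 = ℤ_p`, and `V̄ ≅ E[p]`. Note that there exists
at least one prime `q ∣ N` such that the mod `p` representation `ρ̄_{E,p}` is ramified at `q`. If
not, then Ribet's level lowering theorem [Rib90] yields a cuspform `g` of weight 2 and level 1 with
mod `p` residual representation isomorphic to `ρ̄_{E,p}` (we apply Ribet's theorem to remove,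
one-by-one, the primes dividing `N`). This is a contradiction as there are no cuspidal eigenforms of
weight `2` and level `1`. Let `N = q_1 ⋯ q_r` with `q_1 = q`."

Standing assumptions of §7 (arXiv p. 28, verbatim): "we assume: • `E` is a semistable elliptic
curve with square-free conductor `N`; • `E` has good reduction at the the prime `p` (i.e., `p ∤ N`);
• if `p = 3` and `E` has supersingular reduction at `p`, then `a_p(E) = 0`; • the residual
representation `ρ̄_{E,p} : G_ℚ → Aut(E[p])` is irreducible; • `ord_{s=1} L(E,s) = 1`", `p` being the
odd prime of the Main Theorem (Thm. 1.2.1: `p ≥ 3`; tree fact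
`JetchevSkinnerWan2017.thm121_padicValRat_bsd_rank_one`).

This is the input "(ram) is automatic for semistable `E`" by which §7.4.1 feeds the quadratic twist
`E^{D'}` to the rank-zero `p`-part theorem (Skinner–Urban 2014 Thm. 2 / Skinner 2016 Thm. C, which
require a prime `q ∥ N` with `E[p]` ramified at `q`). ONE named fact (`def … : Prop`, D-0014),
nothing asserted; no `_holds` expected (Ribet's theorem, Invent. Math. 100 (1990) Thm. 1.1, and the
modularity of `ρ̄_{E,p}` are not in Mathlib or the tree). Cell `b2b-bsdres` (BSD rank-≤1 residual
classes; HONEST FRAMING: published theorems only, construction-shaped remainder typed, not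
"finishing BSD"): this is item (ii) of the GLUE seat's sized ask A1 (row C3 at main-conjecture level,
`HOME/b2b-bsdres-lit-glue/GLUE.md` §4).

## Transcription

`W` a globally minimal model of `E/ℚ` (to read `a_p`, `Δ_min` and the reduction types off the
model); "semistable (square-free `N`)" = `Rank1Residual.Semistable W` (good or multiplicative
reduction at every prime); "good reduction at `p`" = `W.HasGoodReductionAtPrime p`; the `p = 3`
proviso verbatim (`p = 3 → 3 ∣ a_3 → a_3 = 0`, supersingular ⟺ `p ∣ a_p` at a good prime); "`ρ̄_{E,p}`
irreducible" = `W.HasIrreducibleModPGaloisRep p`; "`ord_{s=1} L(E,s) = 1`" = `W.analyticRank = 1`;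
`3 ≤ p`. CONCLUSION "a prime `q ∣ N` such that `ρ̄_{E,p}` is ramified at `q`": since `N` is
square-free, `q ∥ N` is a prime of multiplicative reduction, `q ≠ p` because `p ∤ N`, and for a
multiplicative `q ≠ p` "`ρ̄_{E,p}` ramified at `q`" ⟺ `p ∤ v_q(Δ_min)` (Tate curve; the dictionary used
by every (ram) transcription of the tree, bsd.S21/S30, `Rank1Residual.Ram`) — i.e. exactly the
cell's atom `Rank1Residual.Ram W p`. All five standing assumptions are kept as hypotheses (the
printed argument uses only semistability, `p ∤ N`, `p` odd and irreducibility; the fact is stated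
no stronger than the text that prints it).
-- TODO(general form): the same conclusion without `ord_{s=1} L(E,s) = 1` and without the `p = 3`
-- proviso (Ribet 1990 Thm. 1.1 + Serre's level-1 vanishing, for any semistable `E` with `p ∤ N`,
-- `p ≥ 3`, `E[p]` irreducible) is not printed as such in JSW; vendor it from Ribet 1990 directly if
-- a consumer needs it.

## References

* D. Jetchev, C. Skinner, X. Wan, Camb. J. Math. 5 (2017) 369–434, §7 (p. 28), §7.4 (p. 29),
  Thm. 1.2.1. [JetchevSkinnerWan2017]
* K. A. Ribet, *On modular representations of `Gal(ℚ̄/ℚ)` arising from modular forms*, Invent.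
  Math. 100 (1990) 431–476, Thm. 1.1. [Ribet1990]
-/

noncomputable section

open scoped Classical

open WeierstrassCurve Literature.NumberTheory.EllipticCurves.Rank1Residual

namespace Literature.NumberTheory.EllipticCurves.JetchevSkinnerWan2017

/-- **Jetchev–Skinner–Wan 2017, §7.4, first paragraph** (Camb. J. Math. 5 (2017); arXiv:1512.06894
p. 29), as printed under the standing assumptions of §7 (p. 28): for `E/ℚ` semistable with good
reduction at the odd prime `p` (`p ≥ 3`; if `p = 3` and `E` is supersingular at `3` then `a_3 = 0`),
`ρ̄_{E,p}` irreducible and `ord_{s=1} L(E,s) = 1`: "there exists at least one prime `q ∣ N` such that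
the mod `p` representation `ρ̄_{E,p}` is ramified at `q`. If not, then Ribet's level lowering theorem
yields a cuspform `g` of weight 2 and level 1 with mod `p` residual representation isomorphic to
`ρ̄_{E,p}` (we apply Ribet's theorem to remove, one-by-one, the primes dividing `N`). This is a
contradiction as there are no cuspidal eigenforms of weight `2` and level `1`." Transcription
(module docstring): `W` globally minimal; conclusion = the cell's (ram) atom `Ram W p` (a
multiplicative `q ≠ p` with `p ∤ v_q(Δ_min)`, Tate's dictionary for "ramified at `q ∥ N`").
Named fact; nothing asserted. [cite: JetchevSkinnerWan2017, §7.4 first paragraph (arXiv p. 29) with §7 standing assumptions (p. 28)]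
[cite: Ribet1990, Thm. 1.1] -/
def sec74_exists_ramifiedPrime_of_semistable : Prop :=
  ∀ (W : WeierstrassCurve ℚ) [W.IsElliptic] [W.IsGloballyMinimal] (p : ℕ) [Fact p.Prime],
    3 ≤ p → Semistable W → W.HasGoodReductionAtPrime p →
    (p = 3 → (3 : ℤ) ∣ W.frobeniusTrace 3 → W.frobeniusTrace 3 = 0) →
    W.HasIrreducibleModPGaloisRep p → W.analyticRank = 1 → Ram W p

/-- Unfolding (bookkeeping): on the locus of the cell's row C3 at `p ≥ 5` (`ord_{s=1} L(E,s) = 1`,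
semistable, good, irreducible) the fact gives the (ram) atom outright (the `p = 3` proviso is
vacuous). [cite: JetchevSkinnerWan2017, §7.4 first paragraph (arXiv p. 29)] -/
theorem ram_of_sec74_of_five_le (h : sec74_exists_ramifiedPrime_of_semistable)
    (W : WeierstrassCurve ℚ) [W.IsElliptic] [W.IsGloballyMinimal] (p : ℕ) [Fact p.Prime]
    (hp : 5 ≤ p) (hsst : Semistable W) (hgood : W.HasGoodReductionAtPrime p)
    (hirr : W.HasIrreducibleModPGaloisRep p) (hr : W.analyticRank = 1) : Ram W p :=
  h W p (by omega) hsst hgood (fun h3 ↦ by omega) hirr hr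

end Literature.NumberTheory.EllipticCurves.JetchevSkinnerWan2017

end
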